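import Mathlib
import Summits.NavierStokesRegularity.FluidComputer.AbcClassIIX0RowsLow
import Summits.NavierStokesRegularity.FluidComputer.SkewCutBracketTranscript
import Summits.NavierStokesRegularity.FluidComputer.SkewCutBracketReproductions

/-!
# Class-II layer of the skew-cut X0 chain: the five X0 rows as kernel implications — IMPLEMENTATION 1 (i3cert),
# continued (R = 800, 1000; K3 = 41, 43)
(instab4 g7 — implementation 2 of the skew-cut X0 certifier, cell `ns-blowup`, 2026-08-27)

HONEST FRAMING (human ruling D-0035): nothing here is a claim about Navier–Stokes blow-up.
WHAT THIS IS NOT: not NS evidence. MODEL lane (Navier–Stokes linearised about the forced ABC flow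
`U = abcFlow 1 1 1`, `f = νU`); no certificate, number or census word moves: the rows below are
CONDITIONAL on the two facts the certifiers print (their truth is the CERTIFIER AUDIT, not this file).

Twin of `AbcClassIIX0RowsLow/High` (instab4 g7, implementation 2's constants `K4`, `mu2lb*_4`) for
IMPLEMENTATION 1 = i3cert (instab3; Craya frames, Arb balls; kit jobs j249613 / j249239 / j249241 / j250421 /
j250422; the SAME brackets `x1 < x2`, its own cube levels `K3` and certified lower bounds `mu2lb1_3 / mu2lb2_3`
of `MU2_K`, transcripts `SkewCutBracketReproductions.X0R100/300/500`, `SkewCutBracketTranscript.X0R800/1000`),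
for ANY family `e O` of real orthonormal bases of the class-II orbit spaces (`bf`, `am` as in `AbcClassIIBases`):

**`X0R<R>_isLinNSEigenvalue_Ioo_i3`**: IF (T1) the head matrices `[(x + |O|²/R)δ − am]` on `cubeIdx K3` at
`x1, x2` have determinants of opposite signs (i3cert: signs −1 / +1) and (T2) the shell Schur forms on
`cubeIdx (K3+1) ∖ cubeIdx K3` are bounded below by `mu2lb1_3 / mu2lb2_3` (i3cert: `MU2` lower bounds, sharp
form), THEN `∃ λ ∈ (x1, x2)`, `Torus.IsLinNSEigenvalue (1/(2πR)) (Torus.abcFlow 1 1 1) (2πλ)`; and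
**`X0R<R>_isLyapunovUnstable_i3`** (+ FPS06 ⇒ rung R-α). (T3) `mu2lb ≤ x + (K3+2)²/R − √2` is discharged in
the kernel. So every row of record has TWO kernel implications whose two remaining hypotheses are certified
by two code-disjoint programs (cert.py: the `…RowsLow/High` files; i3cert: this file and its sequel). What is
NOT kernel: that i3cert's printed signs / `MU2` bounds ARE (T1)/(T2) for implementation 1's basis (CERTIFIER
AUDIT, INSTAB3-METHOD §10) and its basis clause (per orbit: transversal, class II, conjugate-symmetric,
real-orthonormal, `odim O` in number). Mathlib + the files named; no new definitions.
-/

noncomputable section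

open scoped BigOperators ComplexConjugate InnerProductSpace Matrix
open Finset Matrix

namespace Summit.NavierStokesRegularity.FluidComputer.AbcClassII

open Literature.Analysis.FunctionSpaces Literature.Analysis.FunctionSpaces.Torus
open Literature.Analysis.FunctionSpaces.EuclideanSpace
open Literature.Analysis.FluidPDE Literature.Analysis.FluidPDE.SteadyLattice

/-! ## Implementation 1 rows, continued: R = 800, 1000 (instab4 g7) -/

section Rows

variable (e : ∀ O : Orbit, OrthonormalBasis (Fin (odim O)) ℝ (realSpace O.1))
variable (bf : Idx → Fam)
variable (hbf : ∀ i : Idx, bf i = extend i.1.1 ((e i.1 i.2 : realSpace i.1.1) : EuclideanSpace ℂ (↥i.1.1 × Fin 3)))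
variable (am : Idx → Idx → ℝ)
variable (ham : ∀ i j : Idx, am i j =
  (∑ k ∈ i.1.1, (inner ℂ (bf i k) (Torus.lerayCoeff k (crossForm 1 1 1 (bf j) k)) : ℂ)).re)

include hbf ham

/-! ### Row R = 800 (bracket (0.2985, 0.3185), K = 41; i3cert j250421; transcript `SkewCutBracketTranscript.X0R800`) -/

/-- **X0 row R = 800, implementation 1 (i3cert, Arb), in arbitrary orbit bases**: (T1) opposite head determinant signs on
`cubeIdx 41` at `x1, x2` + (T2) shell Schur forms ≥ `mu2lb1_3 / mu2lb2_3` on the shell `42` (the two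
i3cert facts of j250421, stated about `[(x + |O|²/R)δ − am]` for the auditor's basis) ⇒
`∃ λ ∈ (x1, x2) = (0.2985, 0.3185)`, `Torus.IsLinNSEigenvalue (1/(2π·800)) (Torus.abcFlow 1 1 1) (2πλ)`.
(T3) is discharged from the transcribed rationals. MODEL; conditional on the CERTIFIER AUDIT. -/
theorem X0R800_isLinNSEigenvalue_Ioo_i3
    (hdet : (Matrix.of fun a b : ↥(cubeIdx SkewCutBracketTranscript.X0R800.K3) =>
        (if (a : Idx) = b then ((SkewCutBracketTranscript.X0R800.x1 : ℚ) : ℝ) + onormSq (b : Idx).1 / ((SkewCutBracketTranscript.X0R800.R : ℕ) : ℝ) else 0) - am a b).det *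
      (Matrix.of fun a b : ↥(cubeIdx SkewCutBracketTranscript.X0R800.K3) =>
        (if (a : Idx) = b then ((SkewCutBracketTranscript.X0R800.x2 : ℚ) : ℝ) + onormSq (b : Idx).1 / ((SkewCutBracketTranscript.X0R800.R : ℕ) : ℝ) else 0) - am a b).det < 0)
    (hX₁ : ∀ w : ↥(cubeIdx (SkewCutBracketTranscript.X0R800.K3 + 1) \ cubeIdx SkewCutBracketTranscript.X0R800.K3) → ℝ, ((SkewCutBracketTranscript.X0R800.mu2lb1_3 : ℚ) : ℝ) * (w ⬝ᵥ w) ≤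
      ∑ a : ↥(cubeIdx (SkewCutBracketTranscript.X0R800.K3 + 1) \ cubeIdx SkewCutBracketTranscript.X0R800.K3), (((SkewCutBracketTranscript.X0R800.x1 : ℚ) : ℝ) + onormSq (a : Idx).1 / ((SkewCutBracketTranscript.X0R800.R : ℕ) : ℝ)) * w a ^ 2 -
          Real.sqrt 2 * (w ⬝ᵥ w) -
        w ⬝ᵥ (((Matrix.of fun (a : ↥(cubeIdx (SkewCutBracketTranscript.X0R800.K3 + 1) \ cubeIdx SkewCutBracketTranscript.X0R800.K3)) (b : ↥(cubeIdx SkewCutBracketTranscript.X0R800.K3)) =>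
            (if (a : Idx) = b then ((SkewCutBracketTranscript.X0R800.x1 : ℚ) : ℝ) + onormSq (b : Idx).1 / ((SkewCutBracketTranscript.X0R800.R : ℕ) : ℝ) else 0) - am a b) *
          (Matrix.of fun a b : ↥(cubeIdx SkewCutBracketTranscript.X0R800.K3) =>
            (if (a : Idx) = b then ((SkewCutBracketTranscript.X0R800.x1 : ℚ) : ℝ) + onormSq (b : Idx).1 / ((SkewCutBracketTranscript.X0R800.R : ℕ) : ℝ) else 0) - am a b)⁻¹ *
          (Matrix.of fun (a : ↥(cubeIdx SkewCutBracketTranscript.X0R800.K3)) (b : ↥(cubeIdx (SkewCutBracketTranscript.X0R800.K3 + 1) \ cubeIdx SkewCutBracketTranscript.X0R800.K3)) =>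
            (if (a : Idx) = b then ((SkewCutBracketTranscript.X0R800.x1 : ℚ) : ℝ) + onormSq (b : Idx).1 / ((SkewCutBracketTranscript.X0R800.R : ℕ) : ℝ) else 0) - am a b)) *ᵥ w))
    (hX₂ : ∀ w : ↥(cubeIdx (SkewCutBracketTranscript.X0R800.K3 + 1) \ cubeIdx SkewCutBracketTranscript.X0R800.K3) → ℝ, ((SkewCutBracketTranscript.X0R800.mu2lb2_3 : ℚ) : ℝ) * (w ⬝ᵥ w) ≤
      ∑ a : ↥(cubeIdx (SkewCutBracketTranscript.X0R800.K3 + 1) \ cubeIdx SkewCutBracketTranscript.X0R800.K3), (((SkewCutBracketTranscript.X0R800.x2 : ℚ) : ℝ) + onormSq (a : Idx).1 / ((SkewCutBracketTranscript.X0R800.R : ℕ) : ℝ)) * w a ^ 2 -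
          Real.sqrt 2 * (w ⬝ᵥ w) -
        w ⬝ᵥ (((Matrix.of fun (a : ↥(cubeIdx (SkewCutBracketTranscript.X0R800.K3 + 1) \ cubeIdx SkewCutBracketTranscript.X0R800.K3)) (b : ↥(cubeIdx SkewCutBracketTranscript.X0R800.K3)) =>
            (if (a : Idx) = b then ((SkewCutBracketTranscript.X0R800.x2 : ℚ) : ℝ) + onormSq (b : Idx).1 / ((SkewCutBracketTranscript.X0R800.R : ℕ) : ℝ) else 0) - am a b) *
          (Matrix.of fun a b : ↥(cubeIdx SkewCutBracketTranscript.X0R800.K3) =>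
            (if (a : Idx) = b then ((SkewCutBracketTranscript.X0R800.x2 : ℚ) : ℝ) + onormSq (b : Idx).1 / ((SkewCutBracketTranscript.X0R800.R : ℕ) : ℝ) else 0) - am a b)⁻¹ *
          (Matrix.of fun (a : ↥(cubeIdx SkewCutBracketTranscript.X0R800.K3)) (b : ↥(cubeIdx (SkewCutBracketTranscript.X0R800.K3 + 1) \ cubeIdx SkewCutBracketTranscript.X0R800.K3)) =>
            (if (a : Idx) = b then ((SkewCutBracketTranscript.X0R800.x2 : ℚ) : ℝ) + onormSq (b : Idx).1 / ((SkewCutBracketTranscript.X0R800.R : ℕ) : ℝ) else 0) - am a b)) *ᵥ w)) :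
    ∃ lam ∈ Set.Ioo ((SkewCutBracketTranscript.X0R800.x1 : ℚ) : ℝ) ((SkewCutBracketTranscript.X0R800.x2 : ℚ) : ℝ),
      Torus.IsLinNSEigenvalue (1 / (2 * Real.pi * ((SkewCutBracketTranscript.X0R800.R : ℕ) : ℝ))) (Torus.abcFlow 1 1 1) ((2 * Real.pi * lam : ℝ) : ℂ) := by
  have hs := sqrt_two_lt
  refine isLinNSEigenvalue_Ioo_of_certificate_of_bases e bf hbf am ham (R := ((SkewCutBracketTranscript.X0R800.R : ℕ) : ℝ)) ?_ SkewCutBracketTranscript.X0R800.K3 ?_ ((SkewCutBracketTranscript.X0R800.mu2lb1_3 : ℚ) : ℝ) ((SkewCutBracketTranscript.X0R800.mu2lb2_3 : ℚ) : ℝ) ?_ ?_ ?_ ?_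
    hdet hX₁ hX₂
  · simp only [SkewCutBracketTranscript.X0R800.R]; norm_num
  · simp only [SkewCutBracketTranscript.X0R800.x1, SkewCutBracketTranscript.X0R800.x2]; push_cast; norm_num
  · simp only [SkewCutBracketTranscript.X0R800.mu2lb1_3]; push_cast; norm_num
  · simp only [SkewCutBracketTranscript.X0R800.mu2lb2_3]; push_cast; norm_num
  · simp only [SkewCutBracketTranscript.X0R800.R, SkewCutBracketTranscript.X0R800.K3, SkewCutBracketTranscript.X0R800.x1, SkewCutBracketTranscript.X0R800.mu2lb1_3]; push_cast; nlinarith [hs]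
  · simp only [SkewCutBracketTranscript.X0R800.R, SkewCutBracketTranscript.X0R800.K3, SkewCutBracketTranscript.X0R800.x2, SkewCutBracketTranscript.X0R800.mu2lb2_3]; push_cast; nlinarith [hs]

/-- **X0 row R = 800 ⇒ rung R-α** (CONDITIONAL on FPS06 Thm 2.2 and on the CERTIFIER AUDIT of the two facts):
the forced ABC flow at viscosity `1/(2π·800)` is a Lyapunov-unstable steady state of the true forced
Navier–Stokes dynamics on the unit torus — an INSTABILITY statement, not blow-up. -/
theorem X0R800_isLyapunovUnstable_i3 (hFPS : Torus.fps2006_nonlinear_instability_of_eigenvalue)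
    (hdet : (Matrix.of fun a b : ↥(cubeIdx SkewCutBracketTranscript.X0R800.K3) =>
        (if (a : Idx) = b then ((SkewCutBracketTranscript.X0R800.x1 : ℚ) : ℝ) + onormSq (b : Idx).1 / ((SkewCutBracketTranscript.X0R800.R : ℕ) : ℝ) else 0) - am a b).det *
      (Matrix.of fun a b : ↥(cubeIdx SkewCutBracketTranscript.X0R800.K3) =>
        (if (a : Idx) = b then ((SkewCutBracketTranscript.X0R800.x2 : ℚ) : ℝ) + onormSq (b : Idx).1 / ((SkewCutBracketTranscript.X0R800.R : ℕ) : ℝ) else 0) - am a b).det < 0)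
    (hX₁ : ∀ w : ↥(cubeIdx (SkewCutBracketTranscript.X0R800.K3 + 1) \ cubeIdx SkewCutBracketTranscript.X0R800.K3) → ℝ, ((SkewCutBracketTranscript.X0R800.mu2lb1_3 : ℚ) : ℝ) * (w ⬝ᵥ w) ≤
      ∑ a : ↥(cubeIdx (SkewCutBracketTranscript.X0R800.K3 + 1) \ cubeIdx SkewCutBracketTranscript.X0R800.K3), (((SkewCutBracketTranscript.X0R800.x1 : ℚ) : ℝ) + onormSq (a : Idx).1 / ((SkewCutBracketTranscript.X0R800.R : ℕ) : ℝ)) * w a ^ 2 -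
          Real.sqrt 2 * (w ⬝ᵥ w) -
        w ⬝ᵥ (((Matrix.of fun (a : ↥(cubeIdx (SkewCutBracketTranscript.X0R800.K3 + 1) \ cubeIdx SkewCutBracketTranscript.X0R800.K3)) (b : ↥(cubeIdx SkewCutBracketTranscript.X0R800.K3)) =>
            (if (a : Idx) = b then ((SkewCutBracketTranscript.X0R800.x1 : ℚ) : ℝ) + onormSq (b : Idx).1 / ((SkewCutBracketTranscript.X0R800.R : ℕ) : ℝ) else 0) - am a b) *
          (Matrix.of fun a b : ↥(cubeIdx SkewCutBracketTranscript.X0R800.K3) =>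
            (if (a : Idx) = b then ((SkewCutBracketTranscript.X0R800.x1 : ℚ) : ℝ) + onormSq (b : Idx).1 / ((SkewCutBracketTranscript.X0R800.R : ℕ) : ℝ) else 0) - am a b)⁻¹ *
          (Matrix.of fun (a : ↥(cubeIdx SkewCutBracketTranscript.X0R800.K3)) (b : ↥(cubeIdx (SkewCutBracketTranscript.X0R800.K3 + 1) \ cubeIdx SkewCutBracketTranscript.X0R800.K3)) =>
            (if (a : Idx) = b then ((SkewCutBracketTranscript.X0R800.x1 : ℚ) : ℝ) + onormSq (b : Idx).1 / ((SkewCutBracketTranscript.X0R800.R : ℕ) : ℝ) else 0) - am a b)) *ᵥ w))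
    (hX₂ : ∀ w : ↥(cubeIdx (SkewCutBracketTranscript.X0R800.K3 + 1) \ cubeIdx SkewCutBracketTranscript.X0R800.K3) → ℝ, ((SkewCutBracketTranscript.X0R800.mu2lb2_3 : ℚ) : ℝ) * (w ⬝ᵥ w) ≤
      ∑ a : ↥(cubeIdx (SkewCutBracketTranscript.X0R800.K3 + 1) \ cubeIdx SkewCutBracketTranscript.X0R800.K3), (((SkewCutBracketTranscript.X0R800.x2 : ℚ) : ℝ) + onormSq (a : Idx).1 / ((SkewCutBracketTranscript.X0R800.R : ℕ) : ℝ)) * w a ^ 2 -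
          Real.sqrt 2 * (w ⬝ᵥ w) -
        w ⬝ᵥ (((Matrix.of fun (a : ↥(cubeIdx (SkewCutBracketTranscript.X0R800.K3 + 1) \ cubeIdx SkewCutBracketTranscript.X0R800.K3)) (b : ↥(cubeIdx SkewCutBracketTranscript.X0R800.K3)) =>
            (if (a : Idx) = b then ((SkewCutBracketTranscript.X0R800.x2 : ℚ) : ℝ) + onormSq (b : Idx).1 / ((SkewCutBracketTranscript.X0R800.R : ℕ) : ℝ) else 0) - am a b) *
          (Matrix.of fun a b : ↥(cubeIdx SkewCutBracketTranscript.X0R800.K3) =>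
            (if (a : Idx) = b then ((SkewCutBracketTranscript.X0R800.x2 : ℚ) : ℝ) + onormSq (b : Idx).1 / ((SkewCutBracketTranscript.X0R800.R : ℕ) : ℝ) else 0) - am a b)⁻¹ *
          (Matrix.of fun (a : ↥(cubeIdx SkewCutBracketTranscript.X0R800.K3)) (b : ↥(cubeIdx (SkewCutBracketTranscript.X0R800.K3 + 1) \ cubeIdx SkewCutBracketTranscript.X0R800.K3)) =>
            (if (a : Idx) = b then ((SkewCutBracketTranscript.X0R800.x2 : ℚ) : ℝ) + onormSq (b : Idx).1 / ((SkewCutBracketTranscript.X0R800.R : ℕ) : ℝ) else 0) - am a b)) *ᵥ w)) :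
    Torus.IsLyapunovUnstableSteadyState (1 / (2 * Real.pi * ((SkewCutBracketTranscript.X0R800.R : ℕ) : ℝ)))
      (fun x => (4 * Real.pi ^ 2 * (1 / (2 * Real.pi * ((SkewCutBracketTranscript.X0R800.R : ℕ) : ℝ)))) • Torus.abcFlow 1 1 1 x) (Torus.abcFlow 1 1 1) :=
  isLyapunovUnstable_of_exists_Ioo hFPS (by simp only [SkewCutBracketTranscript.X0R800.R]; norm_num)
    (by simp only [SkewCutBracketTranscript.X0R800.x1]; push_cast; norm_num)
    (X0R800_isLinNSEigenvalue_Ioo_i3 e bf hbf am ham hdet hX₁ hX₂)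

/-! ### Row R = 1000 (bracket (0.3053, 0.3253), K = 43; i3cert j250422; transcript `SkewCutBracketTranscript.X0R1000`) -/

/-- **X0 row R = 1000, implementation 1 (i3cert, Arb), in arbitrary orbit bases**: (T1) opposite head determinant signs on
`cubeIdx 43` at `x1, x2` + (T2) shell Schur forms ≥ `mu2lb1_3 / mu2lb2_3` on the shell `44` (the two
i3cert facts of j250422, stated about `[(x + |O|²/R)δ − am]` for the auditor's basis) ⇒
`∃ λ ∈ (x1, x2) = (0.3053, 0.3253)`, `Torus.IsLinNSEigenvalue (1/(2π·1000)) (Torus.abcFlow 1 1 1) (2πλ)`.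
(T3) is discharged from the transcribed rationals. MODEL; conditional on the CERTIFIER AUDIT. -/
theorem X0R1000_isLinNSEigenvalue_Ioo_i3
    (hdet : (Matrix.of fun a b : ↥(cubeIdx SkewCutBracketTranscript.X0R1000.K3) =>
        (if (a : Idx) = b then ((SkewCutBracketTranscript.X0R1000.x1 : ℚ) : ℝ) + onormSq (b : Idx).1 / ((SkewCutBracketTranscript.X0R1000.R : ℕ) : ℝ) else 0) - am a b).det *
      (Matrix.of fun a b : ↥(cubeIdx SkewCutBracketTranscript.X0R1000.K3) =>
        (if (a : Idx) = b then ((SkewCutBracketTranscript.X0R1000.x2 : ℚ) : ℝ) + onormSq (b : Idx).1 / ((SkewCutBracketTranscript.X0R1000.R : ℕ) : ℝ) else 0) - am a b).det < 0)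
    (hX₁ : ∀ w : ↥(cubeIdx (SkewCutBracketTranscript.X0R1000.K3 + 1) \ cubeIdx SkewCutBracketTranscript.X0R1000.K3) → ℝ, ((SkewCutBracketTranscript.X0R1000.mu2lb1_3 : ℚ) : ℝ) * (w ⬝ᵥ w) ≤
      ∑ a : ↥(cubeIdx (SkewCutBracketTranscript.X0R1000.K3 + 1) \ cubeIdx SkewCutBracketTranscript.X0R1000.K3), (((SkewCutBracketTranscript.X0R1000.x1 : ℚ) : ℝ) + onormSq (a : Idx).1 / ((SkewCutBracketTranscript.X0R1000.R : ℕ) : ℝ)) * w a ^ 2 -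
          Real.sqrt 2 * (w ⬝ᵥ w) -
        w ⬝ᵥ (((Matrix.of fun (a : ↥(cubeIdx (SkewCutBracketTranscript.X0R1000.K3 + 1) \ cubeIdx SkewCutBracketTranscript.X0R1000.K3)) (b : ↥(cubeIdx SkewCutBracketTranscript.X0R1000.K3)) =>
            (if (a : Idx) = b then ((SkewCutBracketTranscript.X0R1000.x1 : ℚ) : ℝ) + onormSq (b : Idx).1 / ((SkewCutBracketTranscript.X0R1000.R : ℕ) : ℝ) else 0) - am a b) *
          (Matrix.of fun a b : ↥(cubeIdx SkewCutBracketTranscript.X0R1000.K3) =>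
            (if (a : Idx) = b then ((SkewCutBracketTranscript.X0R1000.x1 : ℚ) : ℝ) + onormSq (b : Idx).1 / ((SkewCutBracketTranscript.X0R1000.R : ℕ) : ℝ) else 0) - am a b)⁻¹ *
          (Matrix.of fun (a : ↥(cubeIdx SkewCutBracketTranscript.X0R1000.K3)) (b : ↥(cubeIdx (SkewCutBracketTranscript.X0R1000.K3 + 1) \ cubeIdx SkewCutBracketTranscript.X0R1000.K3)) =>
            (if (a : Idx) = b then ((SkewCutBracketTranscript.X0R1000.x1 : ℚ) : ℝ) + onormSq (b : Idx).1 / ((SkewCutBracketTranscript.X0R1000.R : ℕ) : ℝ) else 0) - am a b)) *ᵥ w))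
    (hX₂ : ∀ w : ↥(cubeIdx (SkewCutBracketTranscript.X0R1000.K3 + 1) \ cubeIdx SkewCutBracketTranscript.X0R1000.K3) → ℝ, ((SkewCutBracketTranscript.X0R1000.mu2lb2_3 : ℚ) : ℝ) * (w ⬝ᵥ w) ≤
      ∑ a : ↥(cubeIdx (SkewCutBracketTranscript.X0R1000.K3 + 1) \ cubeIdx SkewCutBracketTranscript.X0R1000.K3), (((SkewCutBracketTranscript.X0R1000.x2 : ℚ) : ℝ) + onormSq (a : Idx).1 / ((SkewCutBracketTranscript.X0R1000.R : ℕ) : ℝ)) * w a ^ 2 -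
          Real.sqrt 2 * (w ⬝ᵥ w) -
        w ⬝ᵥ (((Matrix.of fun (a : ↥(cubeIdx (SkewCutBracketTranscript.X0R1000.K3 + 1) \ cubeIdx SkewCutBracketTranscript.X0R1000.K3)) (b : ↥(cubeIdx SkewCutBracketTranscript.X0R1000.K3)) =>
            (if (a : Idx) = b then ((SkewCutBracketTranscript.X0R1000.x2 : ℚ) : ℝ) + onormSq (b : Idx).1 / ((SkewCutBracketTranscript.X0R1000.R : ℕ) : ℝ) else 0) - am a b) *
          (Matrix.of fun a b : ↥(cubeIdx SkewCutBracketTranscript.X0R1000.K3) =>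
            (if (a : Idx) = b then ((SkewCutBracketTranscript.X0R1000.x2 : ℚ) : ℝ) + onormSq (b : Idx).1 / ((SkewCutBracketTranscript.X0R1000.R : ℕ) : ℝ) else 0) - am a b)⁻¹ *
          (Matrix.of fun (a : ↥(cubeIdx SkewCutBracketTranscript.X0R1000.K3)) (b : ↥(cubeIdx (SkewCutBracketTranscript.X0R1000.K3 + 1) \ cubeIdx SkewCutBracketTranscript.X0R1000.K3)) =>
            (if (a : Idx) = b then ((SkewCutBracketTranscript.X0R1000.x2 : ℚ) : ℝ) + onormSq (b : Idx).1 / ((SkewCutBracketTranscript.X0R1000.R : ℕ) : ℝ) else 0) - am a b)) *ᵥ w)) :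
    ∃ lam ∈ Set.Ioo ((SkewCutBracketTranscript.X0R1000.x1 : ℚ) : ℝ) ((SkewCutBracketTranscript.X0R1000.x2 : ℚ) : ℝ),
      Torus.IsLinNSEigenvalue (1 / (2 * Real.pi * ((SkewCutBracketTranscript.X0R1000.R : ℕ) : ℝ))) (Torus.abcFlow 1 1 1) ((2 * Real.pi * lam : ℝ) : ℂ) := by
  have hs := sqrt_two_lt
  refine isLinNSEigenvalue_Ioo_of_certificate_of_bases e bf hbf am ham (R := ((SkewCutBracketTranscript.X0R1000.R : ℕ) : ℝ)) ?_ SkewCutBracketTranscript.X0R1000.K3 ?_ ((SkewCutBracketTranscript.X0R1000.mu2lb1_3 : ℚ) : ℝ) ((SkewCutBracketTranscript.X0R1000.mu2lb2_3 : ℚ) : ℝ) ?_ ?_ ?_ ?_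
    hdet hX₁ hX₂
  · simp only [SkewCutBracketTranscript.X0R1000.R]; norm_num
  · simp only [SkewCutBracketTranscript.X0R1000.x1, SkewCutBracketTranscript.X0R1000.x2]; push_cast; norm_num
  · simp only [SkewCutBracketTranscript.X0R1000.mu2lb1_3]; push_cast; norm_num
  · simp only [SkewCutBracketTranscript.X0R1000.mu2lb2_3]; push_cast; norm_num
  · simp only [SkewCutBracketTranscript.X0R1000.R, SkewCutBracketTranscript.X0R1000.K3, SkewCutBracketTranscript.X0R1000.x1, SkewCutBracketTranscript.X0R1000.mu2lb1_3]; push_cast; nlinarith [hs]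
  · simp only [SkewCutBracketTranscript.X0R1000.R, SkewCutBracketTranscript.X0R1000.K3, SkewCutBracketTranscript.X0R1000.x2, SkewCutBracketTranscript.X0R1000.mu2lb2_3]; push_cast; nlinarith [hs]

/-- **X0 row R = 1000 ⇒ rung R-α** (CONDITIONAL on FPS06 Thm 2.2 and on the CERTIFIER AUDIT of the two facts):
the forced ABC flow at viscosity `1/(2π·1000)` is a Lyapunov-unstable steady state of the true forced
Navier–Stokes dynamics on the unit torus — an INSTABILITY statement, not blow-up. -/
theorem X0R1000_isLyapunovUnstable_i3 (hFPS : Torus.fps2006_nonlinear_instability_of_eigenvalue)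
    (hdet : (Matrix.of fun a b : ↥(cubeIdx SkewCutBracketTranscript.X0R1000.K3) =>
        (if (a : Idx) = b then ((SkewCutBracketTranscript.X0R1000.x1 : ℚ) : ℝ) + onormSq (b : Idx).1 / ((SkewCutBracketTranscript.X0R1000.R : ℕ) : ℝ) else 0) - am a b).det *
      (Matrix.of fun a b : ↥(cubeIdx SkewCutBracketTranscript.X0R1000.K3) =>
        (if (a : Idx) = b then ((SkewCutBracketTranscript.X0R1000.x2 : ℚ) : ℝ) + onormSq (b : Idx).1 / ((SkewCutBracketTranscript.X0R1000.R : ℕ) : ℝ) else 0) - am a b).det < 0)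
    (hX₁ : ∀ w : ↥(cubeIdx (SkewCutBracketTranscript.X0R1000.K3 + 1) \ cubeIdx SkewCutBracketTranscript.X0R1000.K3) → ℝ, ((SkewCutBracketTranscript.X0R1000.mu2lb1_3 : ℚ) : ℝ) * (w ⬝ᵥ w) ≤
      ∑ a : ↥(cubeIdx (SkewCutBracketTranscript.X0R1000.K3 + 1) \ cubeIdx SkewCutBracketTranscript.X0R1000.K3), (((SkewCutBracketTranscript.X0R1000.x1 : ℚ) : ℝ) + onormSq (a : Idx).1 / ((SkewCutBracketTranscript.X0R1000.R : ℕ) : ℝ)) * w a ^ 2 -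
          Real.sqrt 2 * (w ⬝ᵥ w) -
        w ⬝ᵥ (((Matrix.of fun (a : ↥(cubeIdx (SkewCutBracketTranscript.X0R1000.K3 + 1) \ cubeIdx SkewCutBracketTranscript.X0R1000.K3)) (b : ↥(cubeIdx SkewCutBracketTranscript.X0R1000.K3)) =>
            (if (a : Idx) = b then ((SkewCutBracketTranscript.X0R1000.x1 : ℚ) : ℝ) + onormSq (b : Idx).1 / ((SkewCutBracketTranscript.X0R1000.R : ℕ) : ℝ) else 0) - am a b) *
          (Matrix.of fun a b : ↥(cubeIdx SkewCutBracketTranscript.X0R1000.K3) =>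
            (if (a : Idx) = b then ((SkewCutBracketTranscript.X0R1000.x1 : ℚ) : ℝ) + onormSq (b : Idx).1 / ((SkewCutBracketTranscript.X0R1000.R : ℕ) : ℝ) else 0) - am a b)⁻¹ *
          (Matrix.of fun (a : ↥(cubeIdx SkewCutBracketTranscript.X0R1000.K3)) (b : ↥(cubeIdx (SkewCutBracketTranscript.X0R1000.K3 + 1) \ cubeIdx SkewCutBracketTranscript.X0R1000.K3)) =>
            (if (a : Idx) = b then ((SkewCutBracketTranscript.X0R1000.x1 : ℚ) : ℝ) + onormSq (b : Idx).1 / ((SkewCutBracketTranscript.X0R1000.R : ℕ) : ℝ) else 0) - am a b)) *ᵥ w))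
    (hX₂ : ∀ w : ↥(cubeIdx (SkewCutBracketTranscript.X0R1000.K3 + 1) \ cubeIdx SkewCutBracketTranscript.X0R1000.K3) → ℝ, ((SkewCutBracketTranscript.X0R1000.mu2lb2_3 : ℚ) : ℝ) * (w ⬝ᵥ w) ≤
      ∑ a : ↥(cubeIdx (SkewCutBracketTranscript.X0R1000.K3 + 1) \ cubeIdx SkewCutBracketTranscript.X0R1000.K3), (((SkewCutBracketTranscript.X0R1000.x2 : ℚ) : ℝ) + onormSq (a : Idx).1 / ((SkewCutBracketTranscript.X0R1000.R : ℕ) : ℝ)) * w a ^ 2 -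
          Real.sqrt 2 * (w ⬝ᵥ w) -
        w ⬝ᵥ (((Matrix.of fun (a : ↥(cubeIdx (SkewCutBracketTranscript.X0R1000.K3 + 1) \ cubeIdx SkewCutBracketTranscript.X0R1000.K3)) (b : ↥(cubeIdx SkewCutBracketTranscript.X0R1000.K3)) =>
            (if (a : Idx) = b then ((SkewCutBracketTranscript.X0R1000.x2 : ℚ) : ℝ) + onormSq (b : Idx).1 / ((SkewCutBracketTranscript.X0R1000.R : ℕ) : ℝ) else 0) - am a b) *
          (Matrix.of fun a b : ↥(cubeIdx SkewCutBracketTranscript.X0R1000.K3) =>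
            (if (a : Idx) = b then ((SkewCutBracketTranscript.X0R1000.x2 : ℚ) : ℝ) + onormSq (b : Idx).1 / ((SkewCutBracketTranscript.X0R1000.R : ℕ) : ℝ) else 0) - am a b)⁻¹ *
          (Matrix.of fun (a : ↥(cubeIdx SkewCutBracketTranscript.X0R1000.K3)) (b : ↥(cubeIdx (SkewCutBracketTranscript.X0R1000.K3 + 1) \ cubeIdx SkewCutBracketTranscript.X0R1000.K3)) =>
            (if (a : Idx) = b then ((SkewCutBracketTranscript.X0R1000.x2 : ℚ) : ℝ) + onormSq (b : Idx).1 / ((SkewCutBracketTranscript.X0R1000.R : ℕ) : ℝ) else 0) - am a b)) *ᵥ w)) :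
    Torus.IsLyapunovUnstableSteadyState (1 / (2 * Real.pi * ((SkewCutBracketTranscript.X0R1000.R : ℕ) : ℝ)))
      (fun x => (4 * Real.pi ^ 2 * (1 / (2 * Real.pi * ((SkewCutBracketTranscript.X0R1000.R : ℕ) : ℝ)))) • Torus.abcFlow 1 1 1 x) (Torus.abcFlow 1 1 1) :=
  isLyapunovUnstable_of_exists_Ioo hFPS (by simp only [SkewCutBracketTranscript.X0R1000.R]; norm_num)
    (by simp only [SkewCutBracketTranscript.X0R1000.x1]; push_cast; norm_num)
    (X0R1000_isLinNSEigenvalue_Ioo_i3 e bf hbf am ham hdet hX₁ hX₂)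

end Rows

end Summit.NavierStokesRegularity.FluidComputer.AbcClassII

end
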